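import Summits.Parity.GeneralizedHardyLittlewood.Theses.PrimeLevelFamEdge
import Literature.NumberTheory.LFunctions.KMVSecondMainTermFloor
import Literature.NumberTheory.LFunctions.KMVMomentAsymptoticsUniqueness
import Literature.NumberTheory.LFunctions.KMVMollifierDiagonalMainTerm
import Literature.NumberTheory.LFunctions.KMVDiagonalSlack
import Literature.NumberTheory.LFunctions.IwaniecSarnakFamilyWeightTwoPeterssonPB

/-!
# Route `PrimeLevelFamEdge`, crux K_B `BeyondDiagonalBeatsQuarter` (stmt-Parity-20343): the
# ONE-SIDED fixed-level reduction — an UPPER control of the mollified second moment just beyond the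
# diagonal closes K_B, the positivity coming from Cauchy–Schwarz and a bounded total harmonic mass
# (the REPAIRED Petersson fact at `(1,1)` only) — line `fixed-level-kloosterman`, D-0130 Strategy B

Companion of `OffDiagonalControl.lean` (p530692, two-sided control, Petersson-free). The sign of the
off-diagonal main term matters for K_B: the heart inequality is `second + T₂ < 2·lin²`, one-sided. A
NEGATIVE `T₂` of any size is harmless; so the honest analytic target of Strategy B is an UPPER bound
«Kloosterman–Bessel contribution < slack» (ls-lead WORDS #10 S1, verbatim), not a two-sided one. This
file proves that the one-sided control suffices, the missing lower information being supplied by: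
(i) `sq_firstMainTerm_le_mass_mul_secondMainTerm` — for any window and any MA-consistent
`(T₁, T₂)`: if the total harmonic mass `Σʰ_{f ∈ H_2(q)} 1` is `≤ B` for all large primes, then
`(lin + T₁)² ≤ 2B·(second + T₂)` (Cauchy–Schwarz over the even forms,
`KMV2000.norm_LhPQ_one_sq_le_evenMass_mul`, even mass `≤` total mass, and the two displays at ONE
large good prime — no limit argument); (ii) `T₂_le_of_secondMomentUpperControl` — an upper control
`re Q^h ≤ scale·(second + U) + O(q̂ log⁻³ q̂)` along good primes pins `T₂ ≤ U`;
(iii) `beyondDiagonalBeatsQuarter_of_upperControl_X_sq` — under the REPAIRED Petersson fact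
`KowalskiMichel2000.kowalskiMichel2000_peterssonBound` (p528813; used at `(m,n) = (1,1)` only, side
condition `¬(q ∣ 1 ∧ q ∣ 1)`, through `CentralValueFamilyHalfEdge.abs_totalMass_sub_one_le_pb`,
p531367) an upper control at `X²` on an initial segment `(1, b)`, `b ≤ 3/2`, with slack
`U(Δ') < 4(Δ'−1)/Δ'` gives K_B: Bettin pins `T₁ = 0`, so `4 ≤ 2B(second + T₂)` makes the total
second main term positive, and `T₂ ≤ U` makes it `< 8 = 2·lin²`.
(iv) `secondCorrectionUpperSomewhere_X_sq_of_upperControl` — the upper control alone yields the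
heart stub S2u of the line of record `birth` (`stub_secondCorrectionUpperSomewhere`: `second + T₂ <
2·lin²` at `X²` on a sub-window below `3/2`) by a five-line composition, Petersson-free (tenure
ruling 2026-08-27T12:46:52Z (2); the two-sided control of p530692 does the same through
`abs_T₂_le_of_secondMomentControl`).
R2-G44 hygiene: the refuted `kowalskiMichel2000_petersson` does not occur; nothing is closed ex
falso. The control is DISPLAYED as a hypothesis (it is the line's stub in one-sided form; OPEN =
registry famE-02). Standard axioms. «The programme SEARCHES and TYPES; no claim about Landau–Siegel
zeros, Theorems 1–2 of arXiv:2211.02515 or a repaired Margin232 until a kernel theorem says so.»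
-/

namespace Summit.Parity.GeneralizedHardyLittlewood.Theorems.BeyondDiagonalBeatsQuarter

open Polynomial
open Literature.NumberTheory.LFunctions
open Literature.NumberTheory.LFunctions.KMV2000
open Literature.NumberTheory.EllipticCurves.ModularForms
open Summit.Parity.GeneralizedHardyLittlewood.Theses.PrimeLevelFamEdge

/-- **Cauchy–Schwarz floor with a bounded total mass (no limit, no Petersson).** If the KMV moment
asymptotics hold on a window with extra main terms `(T₁, T₂)`, `P` is admissible, `Δ' ∈ (Δlo, Δhi]`,
`Δ' > 0`, good primes for `Δ'` are unbounded, and the total harmonic mass `Σʰ_{f ∈ H_2(q)} 1` is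
`≤ B` for all primes `q ≥ q₂`, then `(linForm Δ' P 1 + T₁ Δ' P 1)² ≤ 2B·(secondMomentForm Δ' P 1 +
T₂ Δ' P 1)`: at one large good prime, `‖L^h‖² ≤ (even mass)·Q^h ≤ B·Q^h`
(`KMV2000.norm_LhPQ_one_sq_le_evenMass_mul`), and the two displays normalise this to the claim up
to `O(1/log q̂)`. [cite: KowalskiMichelVanderKam2000, §2 p. 6 (display after (5)) and §6 p. 19] -/
theorem sq_firstMainTerm_le_mass_mul_secondMainTerm {Δlo Δhi : ℝ}
    {T₁ T₂ : ℝ → ℝ[X] → ℝ[X] → ℝ} (hMA : MomentAsymptotics Δlo Δhi T₁ T₂) {P : ℝ[X]}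
    (hP : Admissible P) {Δ' : ℝ} (h1 : Δlo < Δ') (h2 : Δ' ≤ Δhi) (hΔ' : 0 < Δ')
    (hgood : GoodPrimesUnbounded Δ') {B : ℝ} {q₂ : ℕ}
    (hmass : ∀ (q : ℕ) [NeZero q], q.Prime → q₂ ≤ q →
      IwaniecSarnak.harmonicSum q 2 (fun _ ↦ (1 : ℝ)) ≤ B) :
    (linForm Δ' P 1 + T₁ Δ' P 1) ^ 2 ≤
      2 * B * (secondMomentForm Δ' P 1 + T₂ Δ' P 1) := by
  classical
  by_contra hle
  set c₁ : ℝ := linForm Δ' P 1 + T₁ Δ' P 1 with hc₁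
  set c₂ : ℝ := secondMomentForm Δ' P 1 + T₂ Δ' P 1 with hc₂
  have hlt : 2 * B * c₂ < c₁ ^ 2 := lt_of_not_ge hle
  set δ : ℝ := c₁ ^ 2 - 2 * B * c₂ with hδ
  have hδpos : 0 < δ := by rw [hδ]; linarith
  set α : ℝ := Real.pi ^ 2 / 6 with hα
  have hαpos : 0 < α := by rw [hα]; positivity
  have hζ : riemannZeta 2 = (α : ℂ) := by rw [riemannZeta_two, hα]; push_cast; ring
  obtain ⟨C, q₀, H⟩ := hMA P 1 hP isEvenOrOdd_one Δ' h1 h2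
  -- threshold for `log q̂`
  set X : ℝ := (2 * α * |c₁| * |C| * Δ' + |B| * |C| * Δ' ^ 2) / (α ^ 2 * δ) + 1 with hX
  obtain ⟨N, hN⟩ := exists_log_qhat_ge X
  obtain ⟨q, inst, hq, hqge, hgoodq⟩ := hgood (max (max q₀ q₂) (max N 40))
  have hq0 : q₀ ≤ q := le_trans (le_trans (le_max_left _ _) (le_max_left _ _)) hqge
  have hq2 : q₂ ≤ q := le_trans (le_trans (le_max_right _ _) (le_max_left _ _)) hqge
  have hqN : N ≤ q := le_trans (le_trans (le_max_left _ _) (le_max_right _ _)) hqge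
  have hq40 : 40 ≤ q := le_trans (le_trans (le_max_right _ _) (le_max_right _ _)) hqge
  set x : ℝ := Real.log (qhat q) with hx
  have hxX : X ≤ x := hN q hqN
  have hX1 : 1 ≤ X := by
    have : 0 ≤ (2 * α * |c₁| * |C| * Δ' + |B| * |C| * Δ' ^ 2) / (α ^ 2 * δ) := by positivity
    rw [hX]; linarith
  have hxpos : 0 < x := by linarith
  have hqhat1 : 1 < qhat q := one_lt_qhat hq40
  have hqhat0 : 0 < qhat q := lt_trans one_pos hqhat1
  have hsq0 : 0 < Real.sqrt (qhat q) := Real.sqrt_pos.2 hqhat0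
  obtain ⟨h1st, h2nd⟩ := H q hq hq0 hgoodq
  rw [hζ] at h1st h2nd
  -- the objects at this prime
  set S : ℂ := LhPQ q P 1 (qhat q ^ Δ') with hS
  set R : ℝ := (QhPQ q P 1 (qhat q ^ Δ')).re with hR
  set ρ : ℝ := α * (Real.sqrt (qhat q) / (Δ' * x)) with hρ
  have hρpos : 0 < ρ := by rw [hρ]; positivity
  set κ : ℝ := 2 * α ^ 2 * (qhat q / (Δ' ^ 2 * x ^ 2)) with hκ
  have hκpos : 0 < κ := by rw [hκ]; positivity
  have hκρ : κ = 2 * ρ ^ 2 := by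
    simp only [hκ, hρ, mul_pow, div_pow, Real.sq_sqrt hqhat0.le]
    ring
  -- first display: ‖S‖ ≥ ρ|c₁| − |C| √q̂ x⁻²
  have hmain₁ : ‖(α : ℂ) * ((Real.sqrt (qhat q) / (Δ' * x) : ℝ) : ℂ) * ((c₁ : ℝ) : ℂ)‖ = ρ * |c₁| := by
    rw [norm_mul, norm_mul, Complex.norm_real, Complex.norm_real, Complex.norm_real,
      Real.norm_eq_abs, Real.norm_eq_abs, Real.norm_eq_abs, abs_of_pos hαpos,
      abs_of_nonneg (by positivity : (0 : ℝ) ≤ Real.sqrt (qhat q) / (Δ' * x)), hρ]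
  set e₁ : ℝ := |C| * Real.sqrt (qhat q) * x⁻¹ ^ 2 with he₁
  have he₁nn : 0 ≤ e₁ := by rw [he₁]; positivity
  have hS₁ : ρ * |c₁| - e₁ ≤ ‖S‖ := by
    have h := norm_sub_norm_le ((α : ℂ) * ((Real.sqrt (qhat q) / (Δ' * x) : ℝ) : ℂ) * ((c₁ : ℝ) : ℂ)) S
    rw [hmain₁, norm_sub_rev] at h
    have hC : C * Real.sqrt (qhat q) * (Real.log (qhat q))⁻¹ ^ 2 ≤ e₁ := by
      rw [he₁, ← hx, mul_assoc, mul_assoc]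
      exact mul_le_mul_of_nonneg_right (le_abs_self C) (by positivity)
    have h1 : ‖S - (α : ℂ) * ((Real.sqrt (qhat q) / (Δ' * x) : ℝ) : ℂ) * ((c₁ : ℝ) : ℂ)‖ ≤ e₁ := by
      rw [hS, hc₁, hx]; exact h1st.trans (hx ▸ hC)
    linarith
  -- second display: R ≤ κ c₂ + |C| q̂ x⁻³
  set e₂ : ℝ := |C| * qhat q * x⁻¹ ^ 3 with he₂
  have he₂nn : 0 ≤ e₂ := by rw [he₂]; positivity
  have hR₂ : R ≤ κ * c₂ + e₂ := by
    have e : (2 * (α : ℂ) ^ 2 * ((qhat q / (Δ' ^ 2 * Real.log (qhat q) ^ 2) : ℝ) : ℂ)) *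
        ((c₂ : ℝ) : ℂ) = ((κ * c₂ : ℝ) : ℂ) := by rw [hκ, hx]; push_cast; ring
    have h := h2nd
    rw [← hc₂] at h
    rw [e] at h
    have h' := (Complex.abs_re_le_norm _).trans h
    rw [Complex.sub_re, Complex.ofReal_re, ← hR] at h'
    have hC : C * qhat q * (Real.log (qhat q))⁻¹ ^ 3 ≤ e₂ := by
      rw [he₂, ← hx, mul_assoc, mul_assoc]
      exact mul_le_mul_of_nonneg_right (le_abs_self C) (by positivity)
    have := (abs_le.1 (h'.trans hC)).2
    linarith
  -- R ≥ 0, even mass ≤ total mass ≤ B, Cauchy–Schwarz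
  have hRnn : 0 ≤ R := by
    rw [hR, QhPQ_one_re_eq_sum]
    exact Finset.sum_nonneg fun f _ ↦
      mul_nonneg (IwaniecSarnak.harmonicWeight_nonneg le_rfl f) (sq_nonneg _)
  set E : ℝ := IwaniecSarnak.harmonicSum q 2
    (fun f ↦ if IwaniecSarnak.rootNumber f = 1 then (1 : ℝ) else 0) with hE
  have hEle : E ≤ IwaniecSarnak.harmonicSum q 2 (fun _ ↦ (1 : ℝ)) := by
    rw [hE]
    exact IwaniecSarnak.harmonicSum_mono le_rfl (finite_newforms0_holds q 2)
      (fun f _ ↦ by split_ifs <;> norm_num)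
  have hEB : E ≤ B := hEle.trans (hmass q hq hq2)
  have hCS : ‖S‖ ^ 2 ≤ E * R := by
    rw [hS, hE, hR]
    exact norm_LhPQ_one_sq_le_evenMass_mul P _
  have hCSB : ‖S‖ ^ 2 ≤ B * R := hCS.trans (mul_le_mul_of_nonneg_right hEB hRnn)
  have hB0 : 0 ≤ B := le_trans (IwaniecSarnak.harmonicSum_nonneg le_rfl (fun _ ↦ zero_le_one))
    (hmass q hq hq2)
  -- combine: (ρ|c₁|)² − 2 ρ|c₁| e₁ ≤ B (κ c₂ + e₂)
  have hkey : (ρ * |c₁|) ^ 2 - 2 * (ρ * |c₁|) * e₁ ≤ B * (κ * c₂ + e₂) := by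
    have hBR : B * R ≤ B * (κ * c₂ + e₂) := mul_le_mul_of_nonneg_left hR₂ hB0
    have ha : 0 ≤ ρ * |c₁| := by positivity
    rcases le_or_gt e₁ (ρ * |c₁|) with hcase | hcase
    · have hsq : (ρ * |c₁| - e₁) ^ 2 ≤ ‖S‖ ^ 2 :=
        pow_le_pow_left₀ (by linarith) hS₁ 2
      have hexp : (ρ * |c₁| - e₁) ^ 2 = (ρ * |c₁|) ^ 2 - 2 * (ρ * |c₁|) * e₁ + e₁ ^ 2 := by ring
      have he2 : 0 ≤ e₁ ^ 2 := sq_nonneg _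
      linarith
    · have hBRnn : 0 ≤ B * R := mul_nonneg hB0 hRnn
      have hprod : 0 ≤ (ρ * |c₁|) * (2 * e₁ - ρ * |c₁|) := mul_nonneg ha (by linarith)
      have hexp : (ρ * |c₁|) ^ 2 - 2 * (ρ * |c₁|) * e₁ = -((ρ * |c₁|) * (2 * e₁ - ρ * |c₁|)) := by
        ring
      linarith
  -- normalise: α² δ x ≤ 2 α |c₁| |C| Δ' + |B| |C| Δ'²
  have hρsq : (ρ * |c₁|) ^ 2 = (κ / 2) * c₁ ^ 2 := by rw [hκρ, mul_pow, sq_abs]; ring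
  have hfinal : α ^ 2 * δ * x ≤ 2 * α * |c₁| * |C| * Δ' + |B| * |C| * Δ' ^ 2 := by
    rw [hρsq] at hkey
    -- (κ/2) δ ≤ 2 ρ |c₁| e₁ + B e₂
    have h3 : (κ / 2) * δ ≤ 2 * (ρ * |c₁|) * e₁ + B * e₂ := by
      have : (κ / 2) * δ = (κ / 2) * c₁ ^ 2 - B * (κ * c₂) := by rw [hδ]; ring
      rw [this]; linarith
    have hBe : B * e₂ ≤ |B| * e₂ := mul_le_mul_of_nonneg_right (le_abs_self B) he₂nn
    have h4 : (κ / 2) * δ ≤ 2 * (ρ * |c₁|) * e₁ + |B| * e₂ := by linarith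
    -- substitute the scales
    have eκ : (κ / 2) * δ = (α ^ 2 * δ * x) * (qhat q / (Δ' ^ 2 * x ^ 3)) := by
      rw [hκ]; field_simp
    have eρ : 2 * (ρ * |c₁|) * e₁ = (2 * α * |c₁| * |C| * Δ') * (qhat q / (Δ' ^ 2 * x ^ 3)) := by
      rw [hρ, he₁]
      conv_rhs => rw [← Real.mul_self_sqrt hqhat0.le]
      field_simp
    have eB : |B| * e₂ = (|B| * |C| * Δ' ^ 2) * (qhat q / (Δ' ^ 2 * x ^ 3)) := by
      rw [he₂]; field_simp
    rw [eκ, eρ, eB, ← add_mul] at h4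
    have hw : 0 < qhat q / (Δ' ^ 2 * x ^ 3) := by positivity
    exact le_of_mul_le_mul_right h4 hw
  have hα2δ : 0 < α ^ 2 * δ := by positivity
  have hxle : x ≤ (2 * α * |c₁| * |C| * Δ' + |B| * |C| * Δ' ^ 2) / (α ^ 2 * δ) := by
    rw [le_div_iff₀ hα2δ]; linarith
  have : X ≤ (2 * α * |c₁| * |C| * Δ' + |B| * |C| * Δ' ^ 2) / (α ^ 2 * δ) := hxX.trans hxle
  rw [hX] at this
  linarith

/-- **An upper second-moment control pins `T₂` from above.** If the KMV moment asymptotics hold on a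
window with extra main terms `(T₁, T₂)` and, at an admissible `P`, an even-or-odd `Q` and a length
`Δ' ∈ (Δlo, Δhi]`, `Δ' > 0`, with good primes unbounded, the true mollified second moment satisfies
`re Q^h(P,Q; q̂^{Δ'}) ≤ 2ζ(2)² q̂/(Δ'² log² q̂)·(second(Δ',P,Q) + U) + C q̂ log⁻³ q̂` for all large
good primes, then `T₂ Δ' P Q ≤ U`.
[cite: KowalskiMichelVanderKam2000, §6 p. 19 (shape of the second-moment display), §2 p. 7 (M ∉ ℤ)] -/
theorem T₂_le_of_secondMomentUpperControl {Δlo Δhi : ℝ} {T₁ T₂ : ℝ → ℝ[X] → ℝ[X] → ℝ}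
    (hMA : MomentAsymptotics Δlo Δhi T₁ T₂) {P Q : ℝ[X]} (hP : Admissible P)
    (hQ : IsEvenOrOdd Q) {Δ' : ℝ} (h1 : Δlo < Δ') (h2 : Δ' ≤ Δhi) (hΔ' : 0 < Δ')
    (hgood : GoodPrimesUnbounded Δ') {U C : ℝ} {q₁ : ℕ}
    (hctl : ∀ (q : ℕ) [NeZero q], q.Prime → q₁ ≤ q → (∀ n : ℕ, (n : ℝ) ≠ qhat q ^ Δ') →
      (QhPQ q P Q (qhat q ^ Δ')).re ≤
        2 * (Real.pi ^ 2 / 6) ^ 2 * (qhat q / (Δ' ^ 2 * Real.log (qhat q) ^ 2)) *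
            (secondMomentForm Δ' P Q + U) +
          C * qhat q * (Real.log (qhat q))⁻¹ ^ 3) :
    T₂ Δ' P Q ≤ U := by
  by_contra hle
  have hlt : U < T₂ Δ' P Q := lt_of_not_ge hle
  obtain ⟨C₂, q₀, H⟩ := hMA P Q hP hQ Δ' h1 h2
  set δ : ℝ := T₂ Δ' P Q - U with hδ
  have hδpos : 0 < δ := by rw [hδ]; linarith
  set z : ℝ := 2 * (Real.pi ^ 2 / 6) ^ 2 with hz
  have hzpos : 0 < z := by rw [hz]; positivity
  have hZ : (2 * riemannZeta 2 ^ 2 : ℂ) = ((z : ℝ) : ℂ) := by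
    rw [riemannZeta_two, hz]; push_cast; ring
  set B : ℝ := (|C| + |C₂|) * Δ' ^ 2 / (z * δ) + 1 with hB
  obtain ⟨N, hN⟩ := exists_log_qhat_ge B
  obtain ⟨q, inst, hq, hqge, hgoodq⟩ := hgood (max (max q₀ q₁) N)
  have hq0 : q₀ ≤ q := le_trans (le_trans (le_max_left _ _) (le_max_left _ _)) hqge
  have hq1 : q₁ ≤ q := le_trans (le_trans (le_max_right _ _) (le_max_left _ _)) hqge
  have hqN : N ≤ q := le_trans (le_max_right _ _) hqge
  have hlg : B ≤ Real.log (qhat q) := hN q hqN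
  have hB1 : 1 ≤ B := by
    have : 0 ≤ (|C| + |C₂|) * Δ' ^ 2 / (z * δ) := by positivity
    rw [hB]; linarith
  have hlgpos : 0 < Real.log (qhat q) := by linarith
  have hqhatpos : 0 < qhat q := by
    unfold qhat
    have : 0 < (q : ℝ) := by exact_mod_cast hq.pos
    positivity
  obtain ⟨-, b1⟩ := H q hq hq0 hgoodq
  have b0 := hctl q hq hq1 hgoodq
  set R : ℝ := (QhPQ q P Q (qhat q ^ Δ')).re with hR
  set r : ℝ := qhat q / (Δ' ^ 2 * Real.log (qhat q) ^ 2) with hr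
  have hrpos : 0 < r := by rw [hr]; positivity
  have hs3 : 0 ≤ qhat q * (Real.log (qhat q))⁻¹ ^ 3 := by positivity
  -- MA: |R − z r (second + T₂)| ≤ |C₂| q̂ log⁻³
  have hb1 : z * r * (secondMomentForm Δ' P Q + T₂ Δ' P Q) - |C₂| * qhat q * (Real.log (qhat q))⁻¹ ^ 3
      ≤ R := by
    have e : (2 * riemannZeta 2 ^ 2 * ((r : ℝ) : ℂ)) *
        ((secondMomentForm Δ' P Q + T₂ Δ' P Q : ℝ) : ℂ) =
        ((z * r * (secondMomentForm Δ' P Q + T₂ Δ' P Q) : ℝ) : ℂ) := by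
      rw [hZ]; push_cast; ring
    rw [e] at b1
    have h' := (Complex.abs_re_le_norm _).trans b1
    rw [Complex.sub_re, Complex.ofReal_re, ← hR] at h'
    have hC : C₂ * qhat q * (Real.log (qhat q))⁻¹ ^ 3 ≤ |C₂| * qhat q * (Real.log (qhat q))⁻¹ ^ 3 := by
      rw [mul_assoc, mul_assoc]
      exact mul_le_mul_of_nonneg_right (le_abs_self C₂) hs3
    have := (abs_le.1 (h'.trans hC)).1
    linarith
  -- control: R ≤ z r (second + U) + |C| q̂ log⁻³
  have hb0 : R ≤ z * r * (secondMomentForm Δ' P Q + U) + |C| * qhat q * (Real.log (qhat q))⁻¹ ^ 3 := by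
    have hC : C * qhat q * (Real.log (qhat q))⁻¹ ^ 3 ≤ |C| * qhat q * (Real.log (qhat q))⁻¹ ^ 3 := by
      rw [mul_assoc, mul_assoc]
      exact mul_le_mul_of_nonneg_right (le_abs_self C) hs3
    linarith [b0, hC]
  have key : z * r * δ ≤ (|C| + |C₂|) * qhat q * (Real.log (qhat q))⁻¹ ^ 3 := by
    have e : z * r * δ = z * r * (secondMomentForm Δ' P Q + T₂ Δ' P Q) -
        z * r * (secondMomentForm Δ' P Q + U) := by rw [hδ]; ring
    rw [e]; linarith
  have key2 : z * δ * Real.log (qhat q) ≤ (|C| + |C₂|) * Δ' ^ 2 := by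
    rw [hr] at key
    have e1 : z * (qhat q / (Δ' ^ 2 * Real.log (qhat q) ^ 2)) * δ =
        (z * δ * Real.log (qhat q)) * (qhat q / (Δ' ^ 2 * Real.log (qhat q) ^ 3)) := by
      field_simp
    have e2 : (|C| + |C₂|) * qhat q * (Real.log (qhat q))⁻¹ ^ 3 =
        ((|C| + |C₂|) * Δ' ^ 2) * (qhat q / (Δ' ^ 2 * Real.log (qhat q) ^ 3)) := by
      field_simp
    rw [e1, e2] at key
    have hw : 0 < qhat q / (Δ' ^ 2 * Real.log (qhat q) ^ 3) := by positivity
    exact le_of_mul_le_mul_right key hw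
  have hzd : 0 < z * δ := mul_pos hzpos hδpos
  have key3 : z * δ * B ≤ (|C| + |C₂|) * Δ' ^ 2 :=
    le_trans (mul_le_mul_of_nonneg_left hlg hzd.le) key2
  rw [hB] at key3
  have e3 : z * δ * ((|C| + |C₂|) * Δ' ^ 2 / (z * δ) + 1) = (|C| + |C₂|) * Δ' ^ 2 + z * δ := by
    field_simp
  rw [e3] at key3
  linarith

/-- **Strategy B's one-sided composition: an UPPER off-diagonal control at `X²` on an initial
segment closes K_B, given the repaired Petersson fact at `(1,1)`.** If for some `b ∈ (1, 3/2]` and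
every `Δ' ∈ (1, b)` the mollified second moment at prime level satisfies, for all large primes `q`
with `q̂^{Δ'} ∉ ℕ`, `re Q^h(X²,1; q̂^{Δ'}) ≤ 2ζ(2)² q̂/(Δ'² log² q̂)·(4 + 4/Δ' + U) + C q̂ log⁻³ q̂`
with a slack `U < 4(Δ'−1)/Δ' = 2·lin² − second` — «the Kloosterman–Bessel contribution is below the
diagonal slack» — then `BeyondDiagonalBeatsQuarter` holds: on `(1, min b Δ)` with the profile `X²`,
Bettin's first moment pins `T₁ = 0`, the control pins `T₂ ≤ U`, and the total harmonic mass bound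
from `kowalskiMichel2000_peterssonBound` at `(1,1)` (`abs_totalMass_sub_one_le_pb`) with
Cauchy–Schwarz gives `4 ≤ 2B(second + T₂)`, so `0 < second + T₂ < 8 = 2·lin²`, value `> ¼`.
[cite: KowalskiMichelVanderKam2000, Thm. 6.1 (30)–(32), §2 p. 6, §6 p. 19]
[cite: KowalskiMichel2000, §2.3 p. 310 (display after (16)) with §2.4.2 (23)]
[cite: Bettin2017, Thm. 1.1] -/
theorem beyondDiagonalBeatsQuarter_of_upperControl_X_sq
    (hPB : KowalskiMichel2000.kowalskiMichel2000_peterssonBound)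
    (hctl : ∃ b : ℝ, 1 < b ∧ b ≤ 3 / 2 ∧ ∀ Δ' : ℝ, 1 < Δ' → Δ' < b →
      ∃ U C : ℝ, U < 4 * (Δ' - 1) / Δ' ∧ ∃ q₁ : ℕ, ∀ (q : ℕ) [NeZero q], q.Prime → q₁ ≤ q →
        (∀ n : ℕ, (n : ℝ) ≠ qhat q ^ Δ') →
          (QhPQ q (X ^ 2) 1 (qhat q ^ Δ')).re ≤
            2 * (Real.pi ^ 2 / 6) ^ 2 * (qhat q / (Δ' ^ 2 * Real.log (qhat q) ^ 2)) *
                (secondMomentForm Δ' (X ^ 2) 1 + U) +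
              C * qhat q * (Real.log (qhat q))⁻¹ ^ 3) :
    BeyondDiagonalBeatsQuarter := by
  intro hF Δ hΔ T₁ T₂ hMA
  obtain ⟨b, hb1, hb32, hwin⟩ := hctl
  -- total mass bound from the repaired Petersson fact at (1,1)
  obtain ⟨Cm, hCm⟩ := CentralValueFamilyHalfEdge.abs_totalMass_sub_one_le_pb hPB
  have hmass : ∀ (q : ℕ) [NeZero q], q.Prime → 1 ≤ q →
      IwaniecSarnak.harmonicSum q 2 (fun _ ↦ (1 : ℝ)) ≤ 1 + |Cm| := by
    intro q _ hq _
    have h := hCm q hq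
    have hq1 : (1 : ℝ) ≤ q := by exact_mod_cast hq.one_lt.le
    have hpow : (q : ℝ) ^ (-(3 / 2 : ℝ)) ≤ 1 :=
      Real.rpow_le_one_of_one_le_of_nonpos hq1 (by norm_num)
    have hCle : Cm * (q : ℝ) ^ (-(3 / 2 : ℝ)) ≤ |Cm| := by
      have := mul_le_mul_of_nonneg_left hpow (abs_nonneg Cm)
      rw [mul_one] at this
      exact le_trans (mul_le_mul_of_nonneg_right (le_abs_self Cm) (by positivity)) this
    have := (abs_le.1 (h.trans hCle)).2
    linarith
  refine ⟨1, min b Δ, le_rfl, lt_min hb1 hΔ, min_le_right _ _, by norm_num, X ^ 2,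
    admissible_X_sq, fun Δ' h1' h2' ↦ ?_⟩
  have hΔ'b : Δ' < b := lt_of_lt_of_le h2' (min_le_left _ _)
  have hΔ'Δ : Δ' < Δ := lt_of_lt_of_le h2' (min_le_right _ _)
  have hΔ'2 : Δ' < 2 := by linarith
  have hΔ'0 : 0 < Δ' := by linarith
  have hgood : GoodPrimesUnbounded Δ' := goodPrimesUnbounded_of_lt_two hΔ'0 hΔ'2
  obtain ⟨U, C, hU, q₁, hq⟩ := hwin Δ' h1' hΔ'b
  have hT₂ : T₂ Δ' (X ^ 2) 1 ≤ U :=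
    T₂_le_of_secondMomentUpperControl hMA admissible_X_sq isEvenOrOdd_one h1' hΔ'Δ.le hΔ'0
      hgood (fun q _ hq' hq₁ hg ↦ hq q hq' hq₁ hg)
  have hT₁ : T₁ Δ' (X ^ 2) 1 = 0 :=
    T₁_apply_one_eq_zero_of_bettin hF admissible_X_sq hMA h1' (lt_min hΔ'Δ hΔ'2)
  have hfloor := sq_firstMainTerm_le_mass_mul_secondMainTerm hMA admissible_X_sq h1' hΔ'Δ.le
    hΔ'0 hgood (B := 1 + |Cm|) (q₂ := 1) hmass
  rw [hT₁, add_zero, linForm_X_sq_one, secondMomentForm_X_sq_one] at hfloor ⊢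
  have hslack : 4 * (Δ' - 1) / Δ' = 4 - 4 / Δ' := by field_simp
  rw [hslack] at hU
  have h2B : 0 < 2 * (1 + |Cm|) := by have := abs_nonneg Cm; linarith
  have hDpos : 0 < 4 + 4 / Δ' + T₂ Δ' (X ^ 2) 1 := by
    by_contra hD
    have hD' : 4 + 4 / Δ' + T₂ Δ' (X ^ 2) 1 ≤ 0 := le_of_not_gt hD
    have hneg : 2 * (1 + |Cm|) * (4 + 4 / Δ' + T₂ Δ' (X ^ 2) 1) ≤ 0 :=
      mul_nonpos_iff.mpr (Or.inl ⟨h2B.le, hD'⟩)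
    linarith
  rw [lt_div_iff₀ (by positivity)]
  linarith

/-- **OD⁺ ⇒ S2u.** A one-sided (upper) control at `X²` on an initial segment yields the registered
heart stub of the line of record `birth`, `stub_secondCorrectionUpperSomewhere` — for every window
and every MA-consistent `(T₁, T₂)`, `second + T₂ < 2·lin²` at `X²` on the sub-window
`(1, min b Δ) ⊆ (1, min Δ 2)`: `T₂ ≤ U < 4(Δ'−1)/Δ'` and `second = 4 + 4/Δ'`, `lin = 2`. No
Petersson input. [cite: KowalskiMichelVanderKam2000, Thm. 6.1 (30)–(32), §6 p. 19] -/
theorem secondCorrectionUpperSomewhere_X_sq_of_upperControl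
    (hctl : ∃ b : ℝ, 1 < b ∧ b ≤ 3 / 2 ∧ ∀ Δ' : ℝ, 1 < Δ' → Δ' < b →
      ∃ U C : ℝ, U < 4 * (Δ' - 1) / Δ' ∧ ∃ q₁ : ℕ, ∀ (q : ℕ) [NeZero q], q.Prime → q₁ ≤ q →
        (∀ n : ℕ, (n : ℝ) ≠ qhat q ^ Δ') →
          (QhPQ q (X ^ 2) 1 (qhat q ^ Δ')).re ≤
            2 * (Real.pi ^ 2 / 6) ^ 2 * (qhat q / (Δ' ^ 2 * Real.log (qhat q) ^ 2)) *
                (secondMomentForm Δ' (X ^ 2) 1 + U) +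
              C * qhat q * (Real.log (qhat q))⁻¹ ^ 3) :
    ∀ Δ : ℝ, 1 < Δ → ∀ T₁ T₂ : ℝ → ℝ[X] → ℝ[X] → ℝ, MomentAsymptotics 1 Δ T₁ T₂ →
      ∃ a b : ℝ, 1 ≤ a ∧ a < b ∧ b ≤ min Δ 2 ∧ a < 3 / 2 ∧ ∀ Δ' : ℝ, a < Δ' → Δ' < b →
        secondMomentForm Δ' (X ^ 2) 1 + T₂ Δ' (X ^ 2) 1 < 2 * linForm Δ' (X ^ 2) 1 ^ 2 := by
  intro Δ hΔ T₁ T₂ hMA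
  obtain ⟨b, hb1, hb32, hwin⟩ := hctl
  refine ⟨1, min b Δ, le_rfl, lt_min hb1 hΔ, ?_, by norm_num, fun Δ' h1' h2' ↦ ?_⟩
  · exact le_min (min_le_right _ _) ((min_le_left _ _).trans (by linarith))
  have hΔ'b : Δ' < b := lt_of_lt_of_le h2' (min_le_left _ _)
  have hΔ'Δ : Δ' < Δ := lt_of_lt_of_le h2' (min_le_right _ _)
  have hΔ'2 : Δ' < 2 := by linarith
  have hΔ'0 : 0 < Δ' := by linarith
  obtain ⟨U, C, hU, q₁, hq⟩ := hwin Δ' h1' hΔ'b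
  have hT₂ : T₂ Δ' (X ^ 2) 1 ≤ U :=
    T₂_le_of_secondMomentUpperControl hMA admissible_X_sq isEvenOrOdd_one h1' hΔ'Δ.le hΔ'0
      (goodPrimesUnbounded_of_lt_two hΔ'0 hΔ'2) (fun q _ hq' hq₁ hg ↦ hq q hq' hq₁ hg)
  rw [linForm_X_sq_one, secondMomentForm_X_sq_one]
  have hslack : 4 * (Δ' - 1) / Δ' = 4 - 4 / Δ' := by field_simp
  rw [hslack] at hU
  linarith

end Summit.Parity.GeneralizedHardyLittlewood.Theorems.BeyondDiagonalBeatsQuarter
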